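import Mathlib
import HarnessLib

/-!
# Summation over dyadic shells: `∑_j (∑_k 2^k c_k φ(2^j c_k))^q ≲ ∑_k (2^k c_k)^q`

Analysis/FunctionSpaces support file (pure `ℝ≥0∞`-sequence combinatorics; no measure theory).
It isolates the counting argument in the dyadic-layer proof of the embedding of the Lorentz
space `L^{3,q}(ℝ³)` into the homogeneous Besov space `Ḃ^{-1+3/r}_{r,q}(ℝ³)`
(`Literature/Analysis/FluidPDE/LorentzBesovEmbedding.lean`; the embedding is the one printed in
N. C. Phuc, J. Math. Fluid Mech. 17 (2015), remark after Thm 1.7, and is classically obtained by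
real interpolation, Bergh–Löfström Thm 5.3.1 with Thm 6.4.5).  In that proof the `j`-th
Littlewood–Paley block of `f` is bounded by `∑_k a_k φ(2^j c_k)` where `c_k = μ{|f| > 2^k}^{1/3}`,
`a_k = 2^k c_k` is the dyadic Lorentz sequence and `φ(x) = x^α` (`x ≤ 1`), `x^{-β}` (`x > 1`) is a
two-sided geometric bump; the present file proves the resulting `ℓ^q` bound

  `∑_j (∑_k 2^k c_k φ(2^j c_k))^q ≤ C(α, β, q) ∑_k (2^k c_k)^q`   (`0 < α`, `0 < β`, `1 ≤ q`)

for an ARBITRARY sequence `c : ℤ → [0, ∞]` (`tsum_rpow_tsum_dyadicBump_le`).  The point (and the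
reason a plain discrete Young inequality does not apply) is that the bump is centred at
`j ≈ -log₂ c_k`, which depends on `k`; grouping the indices `k` into the dyadic shells
`G_i = {k | 2^{-i-1} < c_k ≤ 2^{-i}}` of the VALUES `c_k` turns the sum into a genuine convolution
`∑_i ψ(j-i) T_i`, `T_i = ∑_{k ∈ G_i} a_k`, and inside one shell the `a_k = 2^k c_k` are lacunary, so
`T_i ≤ 4 sup_{G_i} a_k` (`tsum_indicator_dyadicShell_rpow_le`).  The remaining steps are Jensen's
inequality for the probability-like weights `ψ(j-i)/Ψ` (`tsum_mul_rpow_le_rpow_mul_tsum`, from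
Hölder for the counting measure) and the regrouping identities
`tsum_tsum_indicator_le_tsum` / `tsum_le_tsum_tsum_indicator`.

This is elementary bookkeeping written for the tree (no single printed source states it in this
form; the nearest printed arguments are the dyadic proofs of the Marcinkiewicz / Hunt interpolation
theorems, Grafakos, *Classical Fourier Analysis*, 3rd ed., proof of Thm 1.4.19 and Lemma 1.4.20,
where the same shells `A_k` and the same lacunarity are used).  No definitions are introduced: the
bump, the shells and the weights are written out in each statement.

## References

* L. Grafakos, *Classical Fourier Analysis*, 3rd ed., GTM 249 (2014), proofs of Thm 1.4.19 and
  Lemma 1.4.20 (dyadic shells and lacunary sums). [Grafakos2014]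
* J. Bergh, J. Löfström, *Interpolation Spaces*, Springer 1976, Thm 5.3.1, Thm 6.4.5 (the
  interpolation route to the same embedding).
-/

noncomputable section

open Set Function Filter MeasureTheory
open scoped ENNReal NNReal Topology

namespace Literature.Analysis.FunctionSpaces

/-! ## Regrouping a sum along a disjoint family of index sets -/

section Regroup

variable {ι : Type*}

/-- Regrouping, upper bound: if the sets `G i` are pairwise disjoint then
`∑_i ∑_{k ∈ G i} g k ≤ ∑_k g k` (in `[0, ∞]`). [cite: Grafakos2014, proof of Thm 1.4.19 (the pairwise disjoint shells A_k, (1.4.29))] -/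
theorem tsum_tsum_indicator_le_tsum (G : ℤ → Set ι) (g : ι → ℝ≥0∞)
    (hG : ∀ k i i', k ∈ G i → k ∈ G i' → i = i') :
    ∑' i, ∑' k, (G i).indicator g k ≤ ∑' k, g k := by
  classical
  rw [ENNReal.tsum_comm]
  refine ENNReal.tsum_le_tsum fun k => ?_
  by_cases h : ∃ i, k ∈ G i
  · obtain ⟨i, hi⟩ := h
    rw [tsum_eq_single i fun i' hi' => indicator_of_notMem (fun hk => hi' (hG k i' i hk hi)) g,
      indicator_of_mem hi]
  · push Not at h
    simp [indicator_of_notMem (h _)]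

/-- Regrouping, lower bound: if every index `k` with `g k ≠ 0` lies in some `G i` then
`∑_k g k ≤ ∑_i ∑_{k ∈ G i} g k` (in `[0, ∞]`). [cite: Grafakos2014, proof of Thm 1.4.19 (f = ∑_k f χ_{A_k})] -/
theorem tsum_le_tsum_tsum_indicator (G : ℤ → Set ι) (g : ι → ℝ≥0∞)
    (hcover : ∀ k, g k ≠ 0 → ∃ i, k ∈ G i) :
    ∑' k, g k ≤ ∑' i, ∑' k, (G i).indicator g k := by
  classical
  rw [ENNReal.tsum_comm]
  refine ENNReal.tsum_le_tsum fun k => ?_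
  by_cases h0 : g k = 0
  · rw [h0]
    exact bot_le
  · obtain ⟨i, hi⟩ := hcover k h0
    calc g k = (G i).indicator g k := (indicator_of_mem hi g).symm
      _ ≤ ∑' i, (G i).indicator g k := ENNReal.le_tsum i

end Regroup

/-! ## Dyadic shells of the values -/

/-- Monotonicity of `y ↦ 2^y` on `[0,∞]`, strict form read backwards: `2^a < 2^b → a < b`.
[folklore] -/
private theorem lt_of_two_rpow_lt {a b : ℝ} (h : (2 : ℝ≥0∞) ^ a < (2 : ℝ≥0∞) ^ b) : a < b := by
  by_contra hab
  exact absurd h (not_lt.2 (ENNReal.rpow_le_rpow_of_exponent_le one_le_two (not_lt.1 hab)))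

/-- Antitonicity of `x ↦ x^z` for `z ≤ 0` on `[0, ∞]`. [folklore] -/
private theorem rpow_le_rpow_of_nonpos' {x y : ℝ≥0∞} {z : ℝ} (hxy : x ≤ y) (hz : z ≤ 0) :
    y ^ z ≤ x ^ z := by
  have h : x ^ (-z) ≤ y ^ (-z) := ENNReal.rpow_le_rpow hxy (by linarith)
  calc y ^ z = (y ^ (-z))⁻¹ := by rw [ENNReal.rpow_neg, inv_inv]
    _ ≤ (x ^ (-z))⁻¹ := ENNReal.inv_le_inv.2 h
    _ = x ^ z := by rw [ENNReal.rpow_neg, inv_inv]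

/-- **The dyadic shells are disjoint**: `2^{-i-1} < c ≤ 2^{-i}` and `2^{-i'-1} < c ≤ 2^{-i'}` force
`i = i'`. [cite: Grafakos2014, proof of Thm 1.4.19 ((1.4.29): the shells are pairwise disjoint)] -/
theorem dyadicShell_unique {c : ℝ≥0∞} {i i' : ℤ}
    (h1 : (2 : ℝ≥0∞) ^ (-(i : ℝ) - 1) < c) (h2 : c ≤ (2 : ℝ≥0∞) ^ (-(i : ℝ)))
    (h1' : (2 : ℝ≥0∞) ^ (-(i' : ℝ) - 1) < c) (h2' : c ≤ (2 : ℝ≥0∞) ^ (-(i' : ℝ))) : i = i' := by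
  have a1 : (-(i : ℝ) - 1) < -(i' : ℝ) := lt_of_two_rpow_lt (lt_of_lt_of_le h1 h2')
  have a2 : (-(i' : ℝ) - 1) < -(i : ℝ) := lt_of_two_rpow_lt (lt_of_lt_of_le h1' h2)
  have b1 : (i' : ℝ) < i + 1 := by linarith only [a1]
  have b2 : (i : ℝ) < i' + 1 := by linarith only [a2]
  have c1 : i' < i + 1 := by exact_mod_cast b1
  have c2 : i < i' + 1 := by exact_mod_cast b2
  omega

/-- **Every value in `(0, ∞)` lies in a dyadic shell** `2^{-i-1} < c ≤ 2^{-i}`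
(`ENNReal.exists_mem_Ioc_zpow`). [cite: Grafakos2014, proof of Thm 1.4.19 ((1.4.29))] -/
theorem exists_dyadicShell {c : ℝ≥0∞} (h0 : c ≠ 0) (htop : c ≠ ⊤) :
    ∃ i : ℤ, (2 : ℝ≥0∞) ^ (-(i : ℝ) - 1) < c ∧ c ≤ (2 : ℝ≥0∞) ^ (-(i : ℝ)) := by
  obtain ⟨n, hn1, hn2⟩ := ENNReal.exists_mem_Ioc_zpow h0 htop ENNReal.one_lt_two ENNReal.ofNat_ne_top
  refine ⟨-(n + 1), ?_, ?_⟩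
  · have h : (-((-(n + 1) : ℤ) : ℝ) - 1) = ((n : ℤ) : ℝ) := by push_cast; ring
    rw [h, ENNReal.rpow_intCast]
    exact hn1
  · have h : (-((-(n + 1) : ℤ) : ℝ)) = ((n + 1 : ℤ) : ℝ) := by push_cast; ring
    rw [h, ENNReal.rpow_intCast]
    exact hn2

/-! ## The two-sided bump against the shell weights -/

/-- **Bump versus shell weight**: for `c` in the shell `2^{-i-1} < c ≤ 2^{-i}` the bump
`φ(2^j c)`, `φ(x) = x^α` (`x ≤ 1`), `x^{-β}` (`x > 1`), is at most the weight
`ψ(j - i)`, `ψ(n) = 2^{αn}` (`n ≤ 0`), `2^{-β(n-1)}` (`n ≥ 1`) — because `2^{j-i-1} < 2^j c ≤ 2^{j-i}`.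
[cite: Grafakos2014, proof of Lemma 1.4.20 (lacunary bookkeeping on dyadic shells)] -/
theorem dyadicBump_le_shellWeight {α β : ℝ} (hα : 0 < α) (hβ : 0 < β) {c : ℝ≥0∞} {i : ℤ} (j : ℤ)
    (h1 : (2 : ℝ≥0∞) ^ (-(i : ℝ) - 1) < c) (h2 : c ≤ (2 : ℝ≥0∞) ^ (-(i : ℝ))) :
    (if (2 : ℝ≥0∞) ^ (j : ℝ) * c ≤ 1 then ((2 : ℝ≥0∞) ^ (j : ℝ) * c) ^ α
      else ((2 : ℝ≥0∞) ^ (j : ℝ) * c) ^ (-β)) ≤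
      (if j - i ≤ 0 then (2 : ℝ≥0∞) ^ (α * ((j : ℝ) - i))
        else (2 : ℝ≥0∞) ^ (-β * ((j : ℝ) - i - 1))) := by
  have h2j0 : (2 : ℝ≥0∞) ^ (j : ℝ) ≠ 0 :=
    ne_of_gt (ENNReal.rpow_pos two_pos ENNReal.ofNat_ne_top)
  have h2jt : (2 : ℝ≥0∞) ^ (j : ℝ) ≠ ⊤ :=
    ENNReal.rpow_ne_top_of_ne_zero two_ne_zero ENNReal.ofNat_ne_top
  set x : ℝ≥0∞ := (2 : ℝ≥0∞) ^ (j : ℝ) * c with hx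
  have hx1 : (2 : ℝ≥0∞) ^ ((j : ℝ) - i - 1) < x := by
    calc (2 : ℝ≥0∞) ^ ((j : ℝ) - i - 1) = (2 : ℝ≥0∞) ^ (j : ℝ) * (2 : ℝ≥0∞) ^ (-(i : ℝ) - 1) := by
          rw [← ENNReal.rpow_add _ _ two_ne_zero ENNReal.ofNat_ne_top]; ring_nf
      _ < (2 : ℝ≥0∞) ^ (j : ℝ) * c := (ENNReal.mul_lt_mul_iff_right h2j0 h2jt).2 h1
  have hx2 : x ≤ (2 : ℝ≥0∞) ^ ((j : ℝ) - i) := by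
    calc x = (2 : ℝ≥0∞) ^ (j : ℝ) * c := rfl
      _ ≤ (2 : ℝ≥0∞) ^ (j : ℝ) * (2 : ℝ≥0∞) ^ (-(i : ℝ)) := mul_le_mul' le_rfl h2
      _ = (2 : ℝ≥0∞) ^ ((j : ℝ) - i) := by
          rw [← ENNReal.rpow_add _ _ two_ne_zero ENNReal.ofNat_ne_top]; ring_nf
  split_ifs with hle hn hn'
  · -- `x ≤ 1`, `j - i ≤ 0`
    calc x ^ α ≤ ((2 : ℝ≥0∞) ^ ((j : ℝ) - i)) ^ α := ENNReal.rpow_le_rpow hx2 hα.le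
      _ = (2 : ℝ≥0∞) ^ (α * ((j : ℝ) - i)) := by rw [← ENNReal.rpow_mul]; ring_nf
  · -- `x ≤ 1` but `j - i ≥ 1`: impossible, `x > 2^{j-i-1} ≥ 1`
    exfalso
    have hji : (0 : ℝ) ≤ (j : ℝ) - i - 1 := by
      have : (1 : ℤ) ≤ j - i := by omega
      have : (1 : ℝ) ≤ (j : ℝ) - i := by exact_mod_cast this
      linarith
    have h1le : (1 : ℝ≥0∞) ≤ (2 : ℝ≥0∞) ^ ((j : ℝ) - i - 1) := by
      rw [← ENNReal.rpow_zero (x := (2 : ℝ≥0∞))]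
      exact ENNReal.rpow_le_rpow_of_exponent_le one_le_two hji
    exact absurd (lt_of_le_of_lt h1le hx1) (not_lt.2 hle)
  · -- `x > 1` but `j - i ≤ 0`: impossible, `x ≤ 2^{j-i} ≤ 1`
    exfalso
    have hji : (j : ℝ) - i ≤ 0 := by
      have : (j : ℝ) - i ≤ (0 : ℝ) := by exact_mod_cast hn'
      exact this
    have hle1 : (2 : ℝ≥0∞) ^ ((j : ℝ) - i) ≤ 1 := by
      rw [← ENNReal.rpow_zero (x := (2 : ℝ≥0∞))]
      exact ENNReal.rpow_le_rpow_of_exponent_le one_le_two hji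
    exact hle (hx2.trans hle1)
  · -- `x > 1`, `j - i ≥ 1`
    calc x ^ (-β) ≤ ((2 : ℝ≥0∞) ^ ((j : ℝ) - i - 1)) ^ (-β) :=
          rpow_le_rpow_of_nonpos' hx1.le (by linarith)
      _ = (2 : ℝ≥0∞) ^ (-β * ((j : ℝ) - i - 1)) := by rw [← ENNReal.rpow_mul]; ring_nf

/-- The shell weights are summable in both directions: with
`ψ(n) = 2^{αn}` (`n ≤ 0`), `2^{-β(n-1)}` (`n ≥ 1`), `∑_{n ∈ ℤ} ψ(n) < ∞` for `0 < α`, `0 < β`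
(two geometric series). [cite: Grafakos2014, proof of Lemma 1.4.20 (geometric sums over dyadic shells)] -/
theorem tsum_shellWeight_lt_top {α β : ℝ} (hα : 0 < α) (hβ : 0 < β) :
    ∑' n : ℤ, (if n ≤ 0 then (2 : ℝ≥0∞) ^ (α * (n : ℝ))
        else (2 : ℝ≥0∞) ^ (-β * ((n : ℝ) - 1))) < ⊤ := by
  set ψ : ℤ → ℝ≥0∞ := fun n => if n ≤ 0 then (2 : ℝ≥0∞) ^ (α * (n : ℝ))
        else (2 : ℝ≥0∞) ^ (-β * ((n : ℝ) - 1)) with hψ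
  have h2 : ∀ y : ℝ, (2 : ℝ≥0∞) ^ y ≠ ⊤ := fun y =>
    ENNReal.rpow_ne_top_of_ne_zero two_ne_zero ENNReal.ofNat_ne_top
  -- nonnegative part: `ψ n ≤ 2^β (2^{-β})^n`
  have hpos : ∑' n : ℕ, ψ n ≤ (2 : ℝ≥0∞) ^ β * ∑' n : ℕ, ((2 : ℝ≥0∞) ^ (-β)) ^ n := by
    rw [← ENNReal.tsum_mul_left]
    refine ENNReal.tsum_le_tsum fun n => ?_
    rw [← ENNReal.rpow_natCast, ← ENNReal.rpow_mul,
      ← ENNReal.rpow_add _ _ two_ne_zero ENNReal.ofNat_ne_top]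
    rcases Nat.eq_zero_or_pos n with hn | hn
    · subst hn
      have h0 : ((0 : ℕ) : ℤ) ≤ 0 := le_rfl
      simp only [hψ, h0, ↓reduceIte]
      refine ENNReal.rpow_le_rpow_of_exponent_le one_le_two ?_
      simp [hβ.le]
    · have hn' : ¬ ((n : ℤ) ≤ 0) := by omega
      simp only [hψ, hn', ↓reduceIte, Int.cast_natCast]
      exact ENNReal.rpow_le_rpow_of_exponent_le one_le_two (le_of_eq (by ring))
  -- negative part: `ψ(-(n+1)) = 2^{-α(n+1)} ≤ (2^{-α})^n`
  have hneg : ∑' n : ℕ, ψ (-((n : ℤ) + 1)) ≤ ∑' n : ℕ, ((2 : ℝ≥0∞) ^ (-α)) ^ n := by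
    refine ENNReal.tsum_le_tsum fun n => ?_
    have hn : (-((n : ℤ) + 1)) ≤ 0 := by omega
    simp only [hψ, hn, ↓reduceIte]
    rw [← ENNReal.rpow_natCast, ← ENNReal.rpow_mul]
    refine ENNReal.rpow_le_rpow_of_exponent_le one_le_two ?_
    have hn0 : (0 : ℝ) ≤ n := Nat.cast_nonneg n
    push_cast
    nlinarith [hα, hn0]
  have hgeom : ∀ {γ : ℝ}, 0 < γ → ∑' n : ℕ, ((2 : ℝ≥0∞) ^ (-γ)) ^ n < ⊤ := by
    intro γ hγ
    rw [ENNReal.tsum_geometric, ENNReal.inv_lt_top, tsub_pos_iff_lt]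
    exact ENNReal.rpow_lt_one_of_one_lt_of_neg ENNReal.one_lt_two (by linarith)
  have hsplit : ∑' n : ℤ, ψ n = ∑' n : ℕ, ψ n + ∑' n : ℕ, ψ (-((n : ℤ) + 1)) :=
    tsum_of_nat_of_neg_add_one ENNReal.summable ENNReal.summable
  rw [hsplit]
  refine ENNReal.add_lt_top.2 ⟨lt_of_le_of_lt hpos ?_, lt_of_le_of_lt hneg (hgeom hα)⟩
  exact ENNReal.mul_lt_top (lt_top_iff_ne_top.2 (h2 β)) (hgeom hβ)

/-! ## Lacunarity inside one shell -/

/-- Finite geometric bound: `∑_{k ∈ F} 2^k ≤ 2^{K+1}` when every `k ∈ F` is `≤ K`. [folklore] -/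
private theorem sum_two_rpow_le_of_le {F : Finset ℤ} {K : ℤ} (hF : ∀ k ∈ F, k ≤ K) :
    ∑ k ∈ F, (2 : ℝ≥0∞) ^ (k : ℝ) ≤ (2 : ℝ≥0∞) ^ ((K : ℝ) + 1) := by
  classical
  have hinj : Set.InjOn (fun k : ℤ => (K - k).toNat) F := by
    intro k hk k' hk' h
    have h1 : ((K - k).toNat : ℤ) = K - k := Int.toNat_of_nonneg (sub_nonneg.2 (hF k hk))
    have h2 : ((K - k').toNat : ℤ) = K - k' := Int.toNat_of_nonneg (sub_nonneg.2 (hF k' hk'))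
    have h3 : ((K - k).toNat : ℤ) = ((K - k').toNat : ℤ) := by exact_mod_cast h
    linarith
  have hterm : ∀ k ∈ F,
      (2 : ℝ≥0∞) ^ (k : ℝ) = (2 : ℝ≥0∞) ^ (K : ℝ) * (2⁻¹ : ℝ≥0∞) ^ ((K - k).toNat) := by
    intro k hk
    have hk' : ((K - k).toNat : ℤ) = K - k := Int.toNat_of_nonneg (sub_nonneg.2 (hF k hk))
    have hkR : (((K - k).toNat : ℕ) : ℝ) = (K : ℝ) - k := by
      have h := congrArg (Int.cast (R := ℝ)) hk'
      push_cast at h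
      exact h
    rw [← ENNReal.inv_pow, ← ENNReal.rpow_natCast, ← ENNReal.rpow_neg, hkR,
      ← ENNReal.rpow_add _ _ two_ne_zero ENNReal.ofNat_ne_top]
    congr 1
    ring
  calc ∑ k ∈ F, (2 : ℝ≥0∞) ^ (k : ℝ)
      = ∑ k ∈ F, (2 : ℝ≥0∞) ^ (K : ℝ) * (2⁻¹ : ℝ≥0∞) ^ ((K - k).toNat) :=
        Finset.sum_congr rfl hterm
    _ = (2 : ℝ≥0∞) ^ (K : ℝ) * ∑ k ∈ F, (2⁻¹ : ℝ≥0∞) ^ ((K - k).toNat) := by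
        rw [Finset.mul_sum]
    _ = (2 : ℝ≥0∞) ^ (K : ℝ) * ∑ n ∈ F.image (fun k => (K - k).toNat), (2⁻¹ : ℝ≥0∞) ^ n := by
        rw [Finset.sum_image hinj]
    _ ≤ (2 : ℝ≥0∞) ^ (K : ℝ) * ∑' n : ℕ, (2⁻¹ : ℝ≥0∞) ^ n :=
        mul_le_mul' le_rfl (ENNReal.sum_le_tsum _)
    _ = (2 : ℝ≥0∞) ^ (K : ℝ) * 2 := by rw [ENNReal.tsum_geometric_two]
    _ = (2 : ℝ≥0∞) ^ ((K : ℝ) + 1) := by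
        rw [ENNReal.rpow_add _ _ two_ne_zero ENNReal.ofNat_ne_top, ENNReal.rpow_one]

/-- **Lacunarity inside a shell**: on the shell `G_i = {k | 2^{-i-1} < c_k ≤ 2^{-i}}` the
dyadic sequence `a_k = 2^k c_k` satisfies `2^{k-i-1} < a_k ≤ 2^{k-i}`, hence is dominated by a
geometric progression ending at its largest element, and for `1 ≤ q`
`(∑_{k ∈ G_i} a_k)^q ≤ 4^q ∑_{k ∈ G_i} a_k^q`.
[cite: Grafakos2014, proof of Lemma 1.4.20 (lacunary sums over dyadic shells)] -/
theorem tsum_indicator_dyadicShell_rpow_le (c : ℤ → ℝ≥0∞) (i : ℤ) {q : ℝ} (hq : 1 ≤ q) :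
    (∑' k, {k : ℤ | (2 : ℝ≥0∞) ^ (-(i : ℝ) - 1) < c k ∧ c k ≤ (2 : ℝ≥0∞) ^ (-(i : ℝ))}.indicator
        (fun k => (2 : ℝ≥0∞) ^ (k : ℝ) * c k) k) ^ q ≤
      (4 : ℝ≥0∞) ^ q *
        ∑' k, {k : ℤ | (2 : ℝ≥0∞) ^ (-(i : ℝ) - 1) < c k ∧ c k ≤ (2 : ℝ≥0∞) ^ (-(i : ℝ))}.indicator
          (fun k => ((2 : ℝ≥0∞) ^ (k : ℝ) * c k) ^ q) k := by
  classical
  set G : Set ℤ := {k : ℤ | (2 : ℝ≥0∞) ^ (-(i : ℝ) - 1) < c k ∧ c k ≤ (2 : ℝ≥0∞) ^ (-(i : ℝ))}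
    with hG
  set a : ℤ → ℝ≥0∞ := fun k => (2 : ℝ≥0∞) ^ (k : ℝ) * c k with ha
  set B : ℝ≥0∞ := ∑' k, G.indicator (fun k => (a k) ^ q) k with hB
  have hq0 : 0 < q := by linarith
  have h2ne : ∀ y : ℝ, (2 : ℝ≥0∞) ^ y ≠ 0 := fun y =>
    ne_of_gt (ENNReal.rpow_pos two_pos ENNReal.ofNat_ne_top)
  have h2nt : ∀ y : ℝ, (2 : ℝ≥0∞) ^ y ≠ ⊤ := fun y =>
    ENNReal.rpow_ne_top_of_ne_zero two_ne_zero ENNReal.ofNat_ne_top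
  have ha_le : ∀ k ∈ G, a k ≤ (2 : ℝ≥0∞) ^ ((k : ℝ) - i) := fun k hk => by
    calc a k = (2 : ℝ≥0∞) ^ (k : ℝ) * c k := rfl
      _ ≤ (2 : ℝ≥0∞) ^ (k : ℝ) * (2 : ℝ≥0∞) ^ (-(i : ℝ)) := mul_le_mul' le_rfl hk.2
      _ = (2 : ℝ≥0∞) ^ ((k : ℝ) - i) := by
          rw [← ENNReal.rpow_add _ _ two_ne_zero ENNReal.ofNat_ne_top]; ring_nf
  have ha_gt : ∀ k ∈ G, (2 : ℝ≥0∞) ^ ((k : ℝ) - i - 1) < a k := fun k hk => by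
    calc (2 : ℝ≥0∞) ^ ((k : ℝ) - i - 1) = (2 : ℝ≥0∞) ^ (k : ℝ) * (2 : ℝ≥0∞) ^ (-(i : ℝ) - 1) := by
          rw [← ENNReal.rpow_add _ _ two_ne_zero ENNReal.ofNat_ne_top]; ring_nf
      _ < (2 : ℝ≥0∞) ^ (k : ℝ) * c k := (ENNReal.mul_lt_mul_iff_right (h2ne _) (h2nt _)).2 hk.1
  have hterm : ∀ k ∈ G, a k ≤ B ^ (1 / q) := fun k hk => by
    have h1 : (a k) ^ q ≤ B := by
      calc (a k) ^ q = G.indicator (fun k => (a k) ^ q) k :=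
            (indicator_of_mem hk (fun k => (a k) ^ q)).symm
        _ ≤ B := ENNReal.le_tsum k
    calc a k = ((a k) ^ q) ^ (1 / q) := by
          rw [← ENNReal.rpow_mul, mul_one_div_cancel hq0.ne', ENNReal.rpow_one]
      _ ≤ B ^ (1 / q) := ENNReal.rpow_le_rpow h1 (by positivity)
  -- every finite partial sum is at most `4 B^{1/q}`
  have hfin : ∀ F : Finset ℤ, ∑ k ∈ F, G.indicator a k ≤ 4 * B ^ (1 / q) := by
    intro F
    have hsplit : ∑ k ∈ F, G.indicator a k = ∑ k ∈ F.filter (· ∈ G), a k := by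
      rw [Finset.sum_filter]
      refine Finset.sum_congr rfl fun k _ => ?_
      rw [indicator_apply]
    rw [hsplit]
    rcases (F.filter (· ∈ G)).eq_empty_or_nonempty with hE | hne
    · rw [hE, Finset.sum_empty]
      exact bot_le
    · obtain ⟨K, hKF, hKmax⟩ := (F.filter (· ∈ G)).exists_max_image (fun k => k) hne
      have hKG : K ∈ G := (Finset.mem_filter.1 hKF).2
      calc ∑ k ∈ F.filter (· ∈ G), a k
          ≤ ∑ k ∈ F.filter (· ∈ G), (2 : ℝ≥0∞) ^ (-(i : ℝ)) * (2 : ℝ≥0∞) ^ (k : ℝ) := by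
            refine Finset.sum_le_sum fun k hk => ?_
            rw [← ENNReal.rpow_add _ _ two_ne_zero ENNReal.ofNat_ne_top, show -(i : ℝ) + k =
              (k : ℝ) - i by ring]
            exact ha_le k (Finset.mem_filter.1 hk).2
        _ = (2 : ℝ≥0∞) ^ (-(i : ℝ)) * ∑ k ∈ F.filter (· ∈ G), (2 : ℝ≥0∞) ^ (k : ℝ) := by
            rw [Finset.mul_sum]
        _ ≤ (2 : ℝ≥0∞) ^ (-(i : ℝ)) * (2 : ℝ≥0∞) ^ ((K : ℝ) + 1) :=
            mul_le_mul' le_rfl (sum_two_rpow_le_of_le fun k hk => hKmax k hk)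
        _ = 4 * (2 : ℝ≥0∞) ^ ((K : ℝ) - i - 1) := by
            rw [show (4 : ℝ≥0∞) = (2 : ℝ≥0∞) ^ (2 : ℝ) by rw [ENNReal.rpow_two]; norm_num,
              ← ENNReal.rpow_add _ _ two_ne_zero ENNReal.ofNat_ne_top,
              ← ENNReal.rpow_add _ _ two_ne_zero ENNReal.ofNat_ne_top]
            ring_nf
        _ ≤ 4 * a K := mul_le_mul' le_rfl (ha_gt K hKG).le
        _ ≤ 4 * B ^ (1 / q) := mul_le_mul' le_rfl (hterm K hKG)
  have hA : ∑' k, G.indicator a k ≤ 4 * B ^ (1 / q) := by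
    rw [ENNReal.tsum_eq_iSup_sum]
    exact iSup_le hfin
  calc (∑' k, G.indicator a k) ^ q ≤ (4 * B ^ (1 / q)) ^ q := ENNReal.rpow_le_rpow hA hq0.le
    _ = (4 : ℝ≥0∞) ^ q * B := by
        rw [ENNReal.mul_rpow_of_nonneg _ _ hq0.le, ← ENNReal.rpow_mul, one_div_mul_cancel hq0.ne',
          ENNReal.rpow_one]

/-! ## Jensen's inequality for a weighted series -/

/-- **Jensen / Hölder for weighted series in `[0, ∞]`**: for `1 ≤ q`,
`(∑_i w_i T_i)^q ≤ (∑_i w_i)^{q-1} ∑_i w_i T_i^q` (Hölder's inequality for the counting measure with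
exponents `q/(q-1)` and `q`, applied to `w^{(q-1)/q}` and `w^{1/q} T`).
[cite: Grafakos2014, proof of Lemma 1.4.20 (Hölder's inequality on the dyadic sums)] -/
theorem tsum_mul_rpow_le_rpow_mul_tsum (w T : ℤ → ℝ≥0∞) {q : ℝ} (hq : 1 ≤ q) :
    (∑' i, w i * T i) ^ q ≤ (∑' i, w i) ^ (q - 1) * ∑' i, w i * (T i) ^ q := by
  rcases eq_or_lt_of_le hq with h | hq1
  · subst h
    simp
  · have hq0 : 0 < q := by linarith
    have hq1' : 0 < q - 1 := by linarith
    have hpq : Real.HolderConjugate (q / (q - 1)) q := by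
      have h := Real.HolderConjugate.conjExponent hq1
      rw [Real.conjExponent] at h
      exact h.symm
    set f : ℤ → ℝ≥0∞ := fun i => (w i) ^ ((q - 1) / q) with hf
    set g : ℤ → ℝ≥0∞ := fun i => (w i) ^ (1 / q) * T i with hg
    have hH := ENNReal.lintegral_mul_le_Lp_mul_Lq (Measure.count : Measure ℤ) hpq
      (f := f) (g := g) (Measurable.of_discrete).aemeasurable (Measurable.of_discrete).aemeasurable
    simp only [lintegral_count] at hH
    have hfg : ∀ i, (f * g) i = w i * T i := fun i => by
      simp only [Pi.mul_apply, hf, hg]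
      rw [← mul_assoc, ← ENNReal.rpow_add_of_nonneg ((q - 1) / q) (1 / q)
        (div_nonneg hq1'.le hq0.le) (one_div_nonneg.2 hq0.le),
        show (q - 1) / q + 1 / q = 1 by field_simp; ring, ENNReal.rpow_one]
    have hfp : ∀ i, (f i) ^ (q / (q - 1)) = w i := fun i => by
      simp only [hf]
      rw [← ENNReal.rpow_mul, show (q - 1) / q * (q / (q - 1)) = 1 by field_simp, ENNReal.rpow_one]
    have hgq : ∀ i, (g i) ^ q = w i * (T i) ^ q := fun i => by
      simp only [hg]
      rw [ENNReal.mul_rpow_of_nonneg _ _ hq0.le, ← ENNReal.rpow_mul, one_div_mul_cancel hq0.ne',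
        ENNReal.rpow_one]
    simp only [hfg, hfp, hgq] at hH
    calc (∑' i, w i * T i) ^ q
        ≤ ((∑' i, w i) ^ (1 / (q / (q - 1))) * (∑' i, w i * (T i) ^ q) ^ (1 / q)) ^ q :=
          ENNReal.rpow_le_rpow hH hq0.le
      _ = (∑' i, w i) ^ (q - 1) * ∑' i, w i * (T i) ^ q := by
          rw [ENNReal.mul_rpow_of_nonneg _ _ hq0.le, ← ENNReal.rpow_mul, ← ENNReal.rpow_mul,
            one_div_mul_cancel hq0.ne', ENNReal.rpow_one,
            show 1 / (q / (q - 1)) * q = q - 1 by field_simp]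

/-! ## The main estimate -/

/-- **Summation over dyadic shells.**  For `0 < α`, `0 < β`, `1 ≤ q` there is a finite constant `C`
such that for EVERY sequence `c : ℤ → [0, ∞]`, with `a_k = 2^k c_k` and the two-sided bump
`φ(x) = x^α` (`x ≤ 1`), `φ(x) = x^{-β}` (`x > 1`),
`∑_j (∑_k a_k φ(2^j c_k))^q ≤ C ∑_k a_k^q`.
Proof: group `k` into the shells `G_i = {2^{-i-1} < c_k ≤ 2^{-i}}` (`dyadicShell_unique`,
`exists_dyadicShell`); on `G_i`, `φ(2^j c_k) ≤ ψ(j-i)` (`dyadicBump_le_shellWeight`), so the inner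
sum is at most the convolution `∑_i ψ(j-i) T_i`, `T_i = ∑_{G_i} a_k`; Jensen
(`tsum_mul_rpow_le_rpow_mul_tsum`) and the shift invariance of `∑_j ψ(j-i) = Ψ < ∞`
(`tsum_shellWeight_lt_top`) give `∑_j (…)^q ≤ Ψ^q ∑_i T_i^q`, and lacunarity
(`tsum_indicator_dyadicShell_rpow_le`) gives `T_i^q ≤ 4^q ∑_{G_i} a_k^q`; regrouping ends the proof
with `C = Ψ^q 4^q`.  (The dyadic bookkeeping of Grafakos, proofs of Thm 1.4.19 / Lemma 1.4.20,
written for the tree; consumer: the Lorentz–Besov embedding.)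
[cite: Grafakos2014, proofs of Thm 1.4.19 and Lemma 1.4.20 (dyadic shells, lacunarity, Hölder)] -/
theorem tsum_rpow_tsum_dyadicBump_le {α β q : ℝ} (hα : 0 < α) (hβ : 0 < β) (hq : 1 ≤ q) :
    ∃ C : ℝ≥0∞, C < ⊤ ∧ ∀ c : ℤ → ℝ≥0∞,
      ∑' j : ℤ, (∑' k : ℤ, (2 : ℝ≥0∞) ^ (k : ℝ) * c k *
          (if (2 : ℝ≥0∞) ^ (j : ℝ) * c k ≤ 1 then ((2 : ℝ≥0∞) ^ (j : ℝ) * c k) ^ α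
            else ((2 : ℝ≥0∞) ^ (j : ℝ) * c k) ^ (-β))) ^ q ≤
        C * ∑' k : ℤ, ((2 : ℝ≥0∞) ^ (k : ℝ) * c k) ^ q := by
  classical
  set ψ : ℤ → ℝ≥0∞ := fun n => if n ≤ 0 then (2 : ℝ≥0∞) ^ (α * (n : ℝ))
      else (2 : ℝ≥0∞) ^ (-β * ((n : ℝ) - 1)) with hψ
  set Ψ : ℝ≥0∞ := ∑' n, ψ n with hΨ
  have hΨtop : Ψ < ⊤ := tsum_shellWeight_lt_top hα hβ
  have hq0 : 0 < q := by linarith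
  refine ⟨Ψ ^ q * (4 : ℝ≥0∞) ^ q, ENNReal.mul_lt_top (ENNReal.rpow_lt_top_of_nonneg hq0.le hΨtop.ne)
    (ENNReal.rpow_lt_top_of_nonneg hq0.le ENNReal.ofNat_ne_top), fun c => ?_⟩
  set G : ℤ → Set ℤ := fun i =>
    {k : ℤ | (2 : ℝ≥0∞) ^ (-(i : ℝ) - 1) < c k ∧ c k ≤ (2 : ℝ≥0∞) ^ (-(i : ℝ))} with hG
  set a : ℤ → ℝ≥0∞ := fun k => (2 : ℝ≥0∞) ^ (k : ℝ) * c k with ha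
  set φ : ℤ → ℤ → ℝ≥0∞ := fun j k =>
    if (2 : ℝ≥0∞) ^ (j : ℝ) * c k ≤ 1 then ((2 : ℝ≥0∞) ^ (j : ℝ) * c k) ^ α
      else ((2 : ℝ≥0∞) ^ (j : ℝ) * c k) ^ (-β) with hφ
  set T : ℤ → ℝ≥0∞ := fun i => ∑' k, (G i).indicator a k with hT
  change ∑' j, (∑' k, a k * φ j k) ^ q ≤ Ψ ^ q * (4 : ℝ≥0∞) ^ q * ∑' k, (a k) ^ q
  have h2ne : ∀ y : ℝ, (2 : ℝ≥0∞) ^ y ≠ 0 := fun y =>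
    ne_of_gt (ENNReal.rpow_pos two_pos ENNReal.ofNat_ne_top)
  have hGuniq : ∀ k i i', k ∈ G i → k ∈ G i' → i = i' := fun k i i' h h' =>
    dyadicShell_unique h.1 h.2 h'.1 h'.2
  -- Step 1: domination by the convolution with the shell weights
  have hS : ∀ j, ∑' k, a k * φ j k ≤ ∑' i, ψ (j - i) * T i := by
    intro j
    have hcover : ∀ k, a k * φ j k ≠ 0 → ∃ i, k ∈ G i := by
      intro k hk
      have hc0 : c k ≠ 0 := by
        intro h
        apply hk
        simp [ha, h]
      have hct : c k ≠ ⊤ := by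
        intro h
        apply hk
        have htop : (2 : ℝ≥0∞) ^ (j : ℝ) * c k = ⊤ := by rw [h, ENNReal.mul_top (h2ne _)]
        have hφ0 : φ j k = 0 := by
          simp only [hφ, htop]
          rw [if_neg (by simp), ENNReal.top_rpow_of_neg (by linarith)]
        rw [hφ0, mul_zero]
      exact exists_dyadicShell hc0 hct
    calc ∑' k, a k * φ j k
        ≤ ∑' i, ∑' k, (G i).indicator (fun k => a k * φ j k) k :=
          tsum_le_tsum_tsum_indicator G _ hcover
      _ ≤ ∑' i, ∑' k, ψ (j - i) * (G i).indicator a k := by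
          refine ENNReal.tsum_le_tsum fun i => ENNReal.tsum_le_tsum fun k => ?_
          by_cases hk : k ∈ G i
          · rw [indicator_of_mem hk, indicator_of_mem hk, mul_comm]
            refine mul_le_mul' ?_ le_rfl
            have h := dyadicBump_le_shellWeight hα hβ j hk.1 hk.2
            have hcast : ((j - i : ℤ) : ℝ) = (j : ℝ) - i := by push_cast; ring
            simp only [hψ, hcast]
            exact h
          · simp [indicator_of_notMem hk]
      _ = ∑' i, ψ (j - i) * T i := by simp only [hT, ENNReal.tsum_mul_left]
  -- Step 2: Jensen in `i`, with `∑_i ψ(j-i) = Ψ`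
  have hshift : ∀ j, ∑' i, ψ (j - i) = Ψ := fun j => (Equiv.subLeft j).tsum_eq ψ
  have hJ : ∀ j, (∑' i, ψ (j - i) * T i) ^ q ≤ Ψ ^ (q - 1) * ∑' i, ψ (j - i) * (T i) ^ q := by
    intro j
    have h := tsum_mul_rpow_le_rpow_mul_tsum (fun i => ψ (j - i)) T hq
    rwa [hshift j] at h
  -- Step 3: sum over `j` and swap, with `∑_j ψ(j-i) = Ψ`
  have hshift' : ∀ i, ∑' j, ψ (j - i) = Ψ := fun i => (Equiv.subRight i).tsum_eq ψ
  have hswap : ∑' j, ∑' i, ψ (j - i) * (T i) ^ q = Ψ * ∑' i, (T i) ^ q := by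
    rw [ENNReal.tsum_comm]
    calc ∑' i, ∑' j, ψ (j - i) * (T i) ^ q = ∑' i, (∑' j, ψ (j - i)) * (T i) ^ q := by
          simp only [ENNReal.tsum_mul_right]
      _ = ∑' i, Ψ * (T i) ^ q := by simp only [hshift']
      _ = Ψ * ∑' i, (T i) ^ q := ENNReal.tsum_mul_left
  -- Step 4: lacunarity inside the shells, and regrouping
  have hT4 : ∀ i, (T i) ^ q ≤ (4 : ℝ≥0∞) ^ q * ∑' k, (G i).indicator (fun k => (a k) ^ q) k :=
    fun i => tsum_indicator_dyadicShell_rpow_le c i hq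
  have hback : ∑' i, ∑' k, (G i).indicator (fun k => (a k) ^ q) k ≤ ∑' k, (a k) ^ q :=
    tsum_tsum_indicator_le_tsum G _ hGuniq
  have hΨpow : Ψ ^ (q - 1) * Ψ = Ψ ^ q := by
    conv_lhs => rw [show Ψ ^ (q - 1) * Ψ = Ψ ^ (q - 1) * Ψ ^ (1 : ℝ) by rw [ENNReal.rpow_one]]
    rw [← ENNReal.rpow_add_of_nonneg (q - 1) 1 (by linarith) zero_le_one]
    ring_nf
  calc ∑' j, (∑' k, a k * φ j k) ^ q
      ≤ ∑' j, (∑' i, ψ (j - i) * T i) ^ q :=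
        ENNReal.tsum_le_tsum fun j => ENNReal.rpow_le_rpow (hS j) hq0.le
    _ ≤ ∑' j, Ψ ^ (q - 1) * ∑' i, ψ (j - i) * (T i) ^ q := ENNReal.tsum_le_tsum hJ
    _ = Ψ ^ (q - 1) * (Ψ * ∑' i, (T i) ^ q) := by rw [ENNReal.tsum_mul_left, hswap]
    _ = Ψ ^ q * ∑' i, (T i) ^ q := by rw [← mul_assoc, hΨpow]
    _ ≤ Ψ ^ q * ∑' i, (4 : ℝ≥0∞) ^ q * ∑' k, (G i).indicator (fun k => (a k) ^ q) k :=
        mul_le_mul' le_rfl (ENNReal.tsum_le_tsum hT4)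
    _ = Ψ ^ q * (4 : ℝ≥0∞) ^ q * ∑' i, ∑' k, (G i).indicator (fun k => (a k) ^ q) k := by
        rw [ENNReal.tsum_mul_left, mul_assoc]
    _ ≤ Ψ ^ q * (4 : ℝ≥0∞) ^ q * ∑' k, (a k) ^ q := mul_le_mul' le_rfl hback

/-! ## Appended 2026-08-28: the `q = ∞` (supremum) form -/

/-- **Lacunarity inside a shell, supremum form**: on `G_i = {2^{-i-1} < c_k ≤ 2^{-i}}`,
`∑_{k ∈ G_i} 2^k c_k ≤ 4 · sup_{k ∈ G_i} 2^k c_k` (the sequence `2^k c_k` is squeezed between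
`2^{k-i-1}` and `2^{k-i}` there, so the sum is a geometric series ending at its largest term).
[cite: Grafakos2014, proof of Lemma 1.4.20 (lacunary sums over dyadic shells)] -/
theorem tsum_indicator_dyadicShell_le_iSup (c : ℤ → ℝ≥0∞) (i : ℤ) :
    ∑' k, {k : ℤ | (2 : ℝ≥0∞) ^ (-(i : ℝ) - 1) < c k ∧ c k ≤ (2 : ℝ≥0∞) ^ (-(i : ℝ))}.indicator
        (fun k => (2 : ℝ≥0∞) ^ (k : ℝ) * c k) k ≤
      4 * ⨆ k, {k : ℤ | (2 : ℝ≥0∞) ^ (-(i : ℝ) - 1) < c k ∧ c k ≤ (2 : ℝ≥0∞) ^ (-(i : ℝ))}.indicator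
        (fun k => (2 : ℝ≥0∞) ^ (k : ℝ) * c k) k := by
  classical
  set G : Set ℤ := {k : ℤ | (2 : ℝ≥0∞) ^ (-(i : ℝ) - 1) < c k ∧ c k ≤ (2 : ℝ≥0∞) ^ (-(i : ℝ))}
    with hG
  set a : ℤ → ℝ≥0∞ := fun k => (2 : ℝ≥0∞) ^ (k : ℝ) * c k with ha
  set B : ℝ≥0∞ := ⨆ k, G.indicator a k with hB
  have h2ne : ∀ y : ℝ, (2 : ℝ≥0∞) ^ y ≠ 0 := fun y =>
    ne_of_gt (ENNReal.rpow_pos two_pos ENNReal.ofNat_ne_top)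
  have h2nt : ∀ y : ℝ, (2 : ℝ≥0∞) ^ y ≠ ⊤ := fun y =>
    ENNReal.rpow_ne_top_of_ne_zero two_ne_zero ENNReal.ofNat_ne_top
  have ha_le : ∀ k ∈ G, a k ≤ (2 : ℝ≥0∞) ^ (-(i : ℝ)) * (2 : ℝ≥0∞) ^ (k : ℝ) := fun k hk => by
    calc a k = (2 : ℝ≥0∞) ^ (k : ℝ) * c k := rfl
      _ ≤ (2 : ℝ≥0∞) ^ (k : ℝ) * (2 : ℝ≥0∞) ^ (-(i : ℝ)) := mul_le_mul' le_rfl hk.2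
      _ = (2 : ℝ≥0∞) ^ (-(i : ℝ)) * (2 : ℝ≥0∞) ^ (k : ℝ) := mul_comm _ _
  have ha_gt : ∀ k ∈ G, (2 : ℝ≥0∞) ^ ((k : ℝ) - i - 1) < a k := fun k hk => by
    calc (2 : ℝ≥0∞) ^ ((k : ℝ) - i - 1) = (2 : ℝ≥0∞) ^ (k : ℝ) * (2 : ℝ≥0∞) ^ (-(i : ℝ) - 1) := by
          rw [← ENNReal.rpow_add _ _ two_ne_zero ENNReal.ofNat_ne_top]; ring_nf
      _ < (2 : ℝ≥0∞) ^ (k : ℝ) * c k := (ENNReal.mul_lt_mul_iff_right (h2ne _) (h2nt _)).2 hk.1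
  have hterm : ∀ k ∈ G, a k ≤ B := fun k hk => by
    calc a k = G.indicator a k := (indicator_of_mem hk a).symm
      _ ≤ B := le_iSup (fun k => G.indicator a k) k
  have hfin : ∀ F : Finset ℤ, ∑ k ∈ F, G.indicator a k ≤ 4 * B := by
    intro F
    have hsplit : ∑ k ∈ F, G.indicator a k = ∑ k ∈ F.filter (· ∈ G), a k := by
      rw [Finset.sum_filter]
      refine Finset.sum_congr rfl fun k _ => ?_
      rw [indicator_apply]
    rw [hsplit]
    rcases (F.filter (· ∈ G)).eq_empty_or_nonempty with hE | hne
    · rw [hE, Finset.sum_empty]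
      exact bot_le
    · obtain ⟨K, hKF, hKmax⟩ := (F.filter (· ∈ G)).exists_max_image (fun k => k) hne
      have hKG : K ∈ G := (Finset.mem_filter.1 hKF).2
      calc ∑ k ∈ F.filter (· ∈ G), a k
          ≤ ∑ k ∈ F.filter (· ∈ G), (2 : ℝ≥0∞) ^ (-(i : ℝ)) * (2 : ℝ≥0∞) ^ (k : ℝ) :=
            Finset.sum_le_sum fun k hk => ha_le k (Finset.mem_filter.1 hk).2
        _ = (2 : ℝ≥0∞) ^ (-(i : ℝ)) * ∑ k ∈ F.filter (· ∈ G), (2 : ℝ≥0∞) ^ (k : ℝ) := by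
            rw [Finset.mul_sum]
        _ ≤ (2 : ℝ≥0∞) ^ (-(i : ℝ)) * (2 : ℝ≥0∞) ^ ((K : ℝ) + 1) :=
            mul_le_mul' le_rfl (sum_two_rpow_le_of_le fun k hk => hKmax k hk)
        _ = 4 * (2 : ℝ≥0∞) ^ ((K : ℝ) - i - 1) := by
            rw [show (4 : ℝ≥0∞) = (2 : ℝ≥0∞) ^ (2 : ℝ) by rw [ENNReal.rpow_two]; norm_num,
              ← ENNReal.rpow_add _ _ two_ne_zero ENNReal.ofNat_ne_top,
              ← ENNReal.rpow_add _ _ two_ne_zero ENNReal.ofNat_ne_top]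
            ring_nf
        _ ≤ 4 * a K := mul_le_mul' le_rfl (ha_gt K hKG).le
        _ ≤ 4 * B := mul_le_mul' le_rfl (hterm K hKG)
  rw [ENNReal.tsum_eq_iSup_sum]
  exact iSup_le hfin

/-- **Summation over dyadic shells, supremum form (`q = ∞`).**  For `0 < α`, `0 < β` there is a
finite `C` such that for every `c : ℤ → [0, ∞]`, with `a_k = 2^k c_k` and the two-sided bump `φ`,
`sup_j ∑_k a_k φ(2^j c_k) ≤ C · sup_k a_k` (shells + `dyadicBump_le_shellWeight` +
`tsum_indicator_dyadicShell_le_iSup`; `C = 4 ∑_n ψ(n)`).  Consumer: the endpoint embedding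
`L^{3,∞} ⊂ Ḃ^{-1+3/r}_{r,∞}`.
[cite: Grafakos2014, proofs of Thm 1.4.19 and Lemma 1.4.20 (dyadic shells, lacunarity)] -/
theorem iSup_tsum_dyadicBump_le {α β : ℝ} (hα : 0 < α) (hβ : 0 < β) :
    ∃ C : ℝ≥0∞, C < ⊤ ∧ ∀ c : ℤ → ℝ≥0∞,
      (⨆ j : ℤ, ∑' k : ℤ, (2 : ℝ≥0∞) ^ (k : ℝ) * c k *
          (if (2 : ℝ≥0∞) ^ (j : ℝ) * c k ≤ 1 then ((2 : ℝ≥0∞) ^ (j : ℝ) * c k) ^ α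
            else ((2 : ℝ≥0∞) ^ (j : ℝ) * c k) ^ (-β))) ≤
        C * ⨆ k : ℤ, (2 : ℝ≥0∞) ^ (k : ℝ) * c k := by
  classical
  set ψ : ℤ → ℝ≥0∞ := fun n => if n ≤ 0 then (2 : ℝ≥0∞) ^ (α * (n : ℝ))
      else (2 : ℝ≥0∞) ^ (-β * ((n : ℝ) - 1)) with hψ
  set Ψ : ℝ≥0∞ := ∑' n, ψ n with hΨ
  have hΨtop : Ψ < ⊤ := tsum_shellWeight_lt_top hα hβ
  refine ⟨Ψ * 4, ENNReal.mul_lt_top hΨtop ENNReal.ofNat_lt_top, fun c => ?_⟩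
  set G : ℤ → Set ℤ := fun i =>
    {k : ℤ | (2 : ℝ≥0∞) ^ (-(i : ℝ) - 1) < c k ∧ c k ≤ (2 : ℝ≥0∞) ^ (-(i : ℝ))} with hG
  set a : ℤ → ℝ≥0∞ := fun k => (2 : ℝ≥0∞) ^ (k : ℝ) * c k with ha
  set φ : ℤ → ℤ → ℝ≥0∞ := fun j k =>
    if (2 : ℝ≥0∞) ^ (j : ℝ) * c k ≤ 1 then ((2 : ℝ≥0∞) ^ (j : ℝ) * c k) ^ α
      else ((2 : ℝ≥0∞) ^ (j : ℝ) * c k) ^ (-β) with hφ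
  set T : ℤ → ℝ≥0∞ := fun i => ∑' k, (G i).indicator a k with hT
  change (⨆ j, ∑' k, a k * φ j k) ≤ Ψ * 4 * ⨆ k, a k
  have h2ne : ∀ y : ℝ, (2 : ℝ≥0∞) ^ y ≠ 0 := fun y =>
    ne_of_gt (ENNReal.rpow_pos two_pos ENNReal.ofNat_ne_top)
  -- each shell sum is at most `4 sup a`
  have hTle : ∀ i, T i ≤ 4 * ⨆ k, a k := by
    intro i
    refine (tsum_indicator_dyadicShell_le_iSup c i).trans (mul_le_mul' le_rfl ?_)
    exact iSup_mono fun k => indicator_le_self _ _ k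
  -- domination by the convolution with the shell weights (as in the `ℓ^q` form)
  have hS : ∀ j, ∑' k, a k * φ j k ≤ ∑' i, ψ (j - i) * T i := by
    intro j
    have hcover : ∀ k, a k * φ j k ≠ 0 → ∃ i, k ∈ G i := by
      intro k hk
      have hc0 : c k ≠ 0 := by
        intro h
        apply hk
        simp [ha, h]
      have hct : c k ≠ ⊤ := by
        intro h
        apply hk
        have htop : (2 : ℝ≥0∞) ^ (j : ℝ) * c k = ⊤ := by rw [h, ENNReal.mul_top (h2ne _)]
        have hφ0 : φ j k = 0 := by
          simp only [hφ, htop]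
          rw [if_neg (by simp), ENNReal.top_rpow_of_neg (by linarith)]
        rw [hφ0, mul_zero]
      exact exists_dyadicShell hc0 hct
    calc ∑' k, a k * φ j k
        ≤ ∑' i, ∑' k, (G i).indicator (fun k => a k * φ j k) k :=
          tsum_le_tsum_tsum_indicator G _ hcover
      _ ≤ ∑' i, ∑' k, ψ (j - i) * (G i).indicator a k := by
          refine ENNReal.tsum_le_tsum fun i => ENNReal.tsum_le_tsum fun k => ?_
          by_cases hk : k ∈ G i
          · rw [indicator_of_mem hk, indicator_of_mem hk, mul_comm]
            refine mul_le_mul' ?_ le_rfl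
            have h := dyadicBump_le_shellWeight hα hβ j hk.1 hk.2
            have hcast : ((j - i : ℤ) : ℝ) = (j : ℝ) - i := by push_cast; ring
            simp only [hψ, hcast]
            exact h
          · simp [indicator_of_notMem hk]
      _ = ∑' i, ψ (j - i) * T i := by simp only [hT, ENNReal.tsum_mul_left]
  have hshift : ∀ j, ∑' i, ψ (j - i) = Ψ := fun j => (Equiv.subLeft j).tsum_eq ψ
  refine iSup_le fun j => ?_
  calc ∑' k, a k * φ j k ≤ ∑' i, ψ (j - i) * T i := hS j
    _ ≤ ∑' i, ψ (j - i) * (4 * ⨆ k, a k) :=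
        ENNReal.tsum_le_tsum fun i => mul_le_mul' le_rfl (hTle i)
    _ = Ψ * (4 * ⨆ k, a k) := by rw [ENNReal.tsum_mul_right, hshift j]
    _ = Ψ * 4 * ⨆ k, a k := by rw [mul_assoc]

end Literature.Analysis.FunctionSpaces

end
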